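import Summits.BirchSwinnertonDyer.BirchSwinnertonDyer.Theorems.ErratumRoadFiveEulerHalfNotRamNoInertSetOfBirth
import Summits.BirchSwinnertonDyer.BirchSwinnertonDyer.Theorems.ErratumRoadFiveEulerHalfNotRamInertSavedOfCarrierE0Prime
import Summits.BirchSwinnertonDyer.BirchSwinnertonDyer.Theorems.ErratumRoadFiveEulerHalfNotRamInertSavedOfCarrierReceptacle
import HarnessLib

/-!
# Route `ErratumRoadFive` (K2, `p ≥ 5`), crux `EulerHalfNotRamNoInertSetAtFive` (item stmt-BirchSwinnertonDyer-19715), line `birth` v13: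
# THE CRUX BY NAME FROM THE SIX ROUTE ITEMS + THE TWO PRINTED FACTS + **SAV** (the saved inert display, ∀-form) — and hence from LAB′ (E′-label)
# or LAB♭ (receptacle currency) in place of LAB (cell `bsd-stepL`, width seat `bsd-line-er5-p1-w3` g5; `--supports stmt-BirchSwinnertonDyer-19715 --as helper`)

WHY THIS FILE. -w2 g3's importable composition `EulerHalfBirthAssembly.eulerHalfNotRamNoInertSetAtFive_of_items_of_twoPrintFacts_of_LAB` (p632931) takes LAB
(`stub_shimuraCarrierLabelsB6AtFive`'s text) and uses it ONLY through the saved display SAV (`EulerHalfPAnchor.shimuraInertSavedDisplayAtFive_of_LAB` inside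
`eulerHalfNotRam_otherMult_of_items_of_LAB`). THIS FILE states the composition with SAV ITSELF as the binder (v9's `stub_shimuraInertSavedDisplayAtFive`
∀-form) — `…_of_SAV` — and plugs in this seat's SAV suppliers from the two weaker typings of the identity-component input:
`…_of_LABPrime` (LAB′: Gross's E′-label at the carriers, `…InertSavedOfCarrierE0Prime`) and `…_of_LABFlat` (LAB♭: receptacle currency at the carriers,
`…InertSavedOfCarrierReceptacle`, bsd-idea-9 g7's proposal). So if the planner re-types item (ii) `ShimuraCarrierLabelsB6FromFive` in either currency, the
crux's closer is the same five-line file with this theorem in place of p632931's.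

HONEST FRAMING: THEOREMS ONLY (no definition, no named fact, no `sorry`); CONDITIONAL on the displayed inputs (six route items — `X11aLowerHalf` is a crux —,
two printed named facts, and SAV ∕ LAB′ ∕ LAB♭ — beyond print in the kernel); no stub credit claimed (`--as helper`); item 19715 is NOT closed; no census
number moves; BSD is proved for no curve; no summit statement is touched (T7).
-- adapted from Summits/…/Theorems/ErratumRoadFiveEulerHalfNotRamNoInertSetOfBirth.lean (p632931): `hLabT` ↦ `hSav`, the p-anchor entered through
-- `EulerHalfPAnchor.eulerHalfNotRam_otherMult_of_pAnchor` (its own `hSav` binder) instead of `…_of_items_of_LAB`.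
References (locators only): [cite: Jetchev2008, Thm. 1.1, Thm. 1.4, Cor. 1.5] [cite: PastenShimura2024, Prop. 6.13, Lemma 6.15, Lemma 6.18, §6.6]
[cite: GrossLMS1991, Prop. 3.7 (2) (p. 240), §6 proof of Prop. 6.2 (1) (p. 245)] [cite: GrossZagier1986Heegner, III (3.1)] [cite: McCallumLMS1991, Cor. 5.6]
[cite: MilneADT2006, Ch. I Thm. 4.10(b)] [cite: CaiShuTian2014, Thm. 1.5]. presearch: n/a (assembly of tree theorems). Axioms: `propext`, `Classical.choice`, `Quot.sound`.
-/

set_option autoImplicit false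
set_option linter.dupNamespace false -- `Summit.BirchSwinnertonDyer.BirchSwinnertonDyer` (summit = problem), tree-wide

noncomputable section

open scoped Classical NumberField

namespace Summit.BirchSwinnertonDyer.BirchSwinnertonDyer.Theorems.EulerHalfBirthAssembly

open Summit.BirchSwinnertonDyer.BirchSwinnertonDyer.Theses.ErratumRoadFive
open Literature.NumberTheory.EllipticCurves Literature.NumberTheory.EllipticCurves.Rank1Residual
open Summit.BirchSwinnertonDyer.Rank1Residual Summit.BirchSwinnertonDyer.BirchSwinnertonDyer

/-! ### §1 The crux from the items + the two printed facts + SAV -/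

/-- **CRUX 19715 BY NAME FROM THE SIX ROUTE ITEMS + THE TWO PRINTED FACTS + SAV.** `Theses.ErratumRoadFive.EulerHalfNotRamNoInertSetAtFive` from
`PublishedInputsFive`, `X11aLowerHalf`, `ShimuraParametrizationDataNonempty`, `PastenComponentOrdersInput`, `ShimuraCasselsTateLevelInputs`,
`ShimuraHeegnerEulerSystemInertPrintedR`, Gross 1991 Prop. 3.7 (2) image-free, Gross §6 ∕ [GZ86 III (3.1)] `E⁰`, and the SAVED INERT DISPLAY `hSav` (v9's
`stub_shimuraInertSavedDisplayAtFive` ∀-form VERBATIM = the `hSav` binder of `EulerHalfPAnchor.eulerHalfNotRam_otherMult_of_pAnchor`). PROOF = p632931's: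
`p` the only multiplicative prime ⟹ S1b (`res_pOnlyMultCarrierAtFive_of_items_of_twoPrintFacts`); otherwise the p-anchor on `hSav` with the inert display from
the items (`EulerHalfPAnchor.shimuraInertDisplayKolyvagin_of_items`). CONDITIONAL; 19715 NOT closed by this helper.
[cite: Jetchev2008, Thm. 1.4, Cor. 1.5] [cite: PastenShimura2024, Prop. 6.13, Lemma 6.18, §6.6] [cite: SilvermanATAEC1994, Cor. IV.9.2 (d)] -/
theorem eulerHalfNotRamNoInertSetAtFive_of_items_of_twoPrintFacts_of_SAV
    (h₅ : PublishedInputsFive) (h₃ : X11aLowerHalf) (hJL : ShimuraParametrizationDataNonempty)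
    (hCO : PastenComponentOrdersInput) (hCTi : ShimuraCasselsTateLevelInputs)
    (hESi : ShimuraHeegnerEulerSystemInertPrintedR)
    (hF₁ : GrossLMS1991.prop37_2_frobeniusCongruence)
    (hF₃ : Gross1991_heegnerPoint_sub_ratTorsion_mem_E0)
    (hSav : ∀ (W : WeierstrassCurve ℚ) [W.IsElliptic] [W.IsGloballyMinimal] (p : ℕ) [Fact p.Prime]
      (q₁ : ℕ) [Fact q₁.Prime], ClassX11b W p → 5 ≤ p → Surj W p → ¬ Ram W p →
      W.HasSplitMultiplicativeReductionAtPrime q₁ → p ∣ padicValInt q₁ W.minimalDiscriminantInt →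
      Theorems.ShimuraInertSavedDisplayAtD W p q₁) :
    EulerHalfNotRamNoInertSetAtFive := by
  intro W _ _ p _ hX hp5 hsurj hram htam _hno
  by_cases h : ∀ (ℓ : ℕ) [Fact ℓ.Prime], W.HasMultiplicativeReductionAtPrime ℓ → ℓ = p
  · -- `p` is the only multiplicative prime: the split carrier that `p ∣ ∏c` provides is multiplicative, hence it is `p`
    obtain ⟨ℓ, hℓ, hsplit, hdvd⟩ := (X11b.dvd_tamagawaProduct_iff_exists_split (W := W) (Fact.out : p.Prime) hp5).mp htam
    have hℓp : ℓ = p := h ℓ hsplit.hasMultiplicativeReductionAtPrime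
    subst hℓp
    exact res_pOnlyMultCarrierAtFive_of_items_of_twoPrintFacts h₅ h₃ hCTi hF₁ hF₃ W _ hX hp5 hsurj hram htam h hsplit hdvd
  · have hother : ∃ (ℓ : ℕ) (_ : Fact ℓ.Prime), ℓ ≠ p ∧ W.HasMultiplicativeReductionAtPrime ℓ := by
      by_contra hc
      exact h fun ℓ _ hm ↦ by_contra fun hne ↦ hc ⟨ℓ, ‹_›, hne, hm⟩
    exact Theorems.EulerHalfPAnchor.eulerHalfNotRam_otherMult_of_pAnchor h₅ h₃ hJL hCO
      (Theorems.EulerHalfPAnchor.shimuraInertDisplayKolyvagin_of_items h₅ hCTi hESi) hSav W p hX hp5 hsurj hram hother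

/-! ### §2 … hence from LAB′ (E′-label at the carriers) or LAB♭ (receptacle currency at the carriers) -/

/-- **CRUX 19715 BY NAME FROM THE SIX ROUTE ITEMS + THE TWO PRINTED FACTS + LAB′** (LAB with its (B6) conjunct at each carrier `q ∉ S`, `p ∣ c_q(E)`, replaced
by Gross's E′-label «some prime-to-`p` multiple of `ys m` lies in `E₀(K[m])_w` at every `w ∣ q`»): §1 on the SAV supplier
`EulerHalfInertUpToOne.stub_shimuraInertSavedDisplayAtFive_of_carrierLabelsE0Prime` (Poitou–Tate for Selmer structures from the kernel theorem
`selmerComplement_canonical_holds`; Cassels–Tate level inputs = the item `hCTi`). LAB ⟹ LAB′ (`carrierLabelsE0Prime_of_carrierLabelsB6`), so this is WEAKER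
input than p632931's. CONDITIONAL; 19715 NOT closed by this helper. [cite: GrossLMS1991, §6, proof of Prop. 6.2 (1), p. 245] [cite: Jetchev2008, Cor. 1.5] -/
theorem eulerHalfNotRamNoInertSetAtFive_of_items_of_twoPrintFacts_of_LABPrime
    (h₅ : PublishedInputsFive) (h₃ : X11aLowerHalf) (hJL : ShimuraParametrizationDataNonempty)
    (hCO : PastenComponentOrdersInput) (hCTi : ShimuraCasselsTateLevelInputs)
    (hESi : ShimuraHeegnerEulerSystemInertPrintedR)
    (hF₁ : GrossLMS1991.prop37_2_frobeniusCongruence)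
    (hF₃ : Gross1991_heegnerPoint_sub_ratTorsion_mem_E0)
    (hLabE0T : ∀ (W : WeierstrassCurve ℚ) [W.IsElliptic] [W.IsGloballyMinimal] (p : ℕ) [Fact p.Prime],
      ClassX11b W p → 5 ≤ p →
      ∀ (N : ℕ) [NeZero N] (K : Type) [Field K] [NumberField K] (S : Finset ℕ) (Dt : ModularForms.ModularParametrizationData W N)
        (X : Literature.NumberTheory.Automorphic.ShimuraCurveData (∏ q ∈ S, q) (N / ∏ q ∈ S, q)) (W' : WeierstrassCurve ℚ) [W'.IsElliptic]
        (P₀ : Literature.NumberTheory.Automorphic.ShimuraParametrizationData X W'),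
        W.conductorNorm ℤ = N → IsImaginaryQuadratic K → NumberField.discr K < -4 → Even S.card →
        (∀ ℓ ∈ S, ℓ.Prime ∧ ℓ ∣ N ∧ ¬ ℓ ^ 2 ∣ N ∧
          ((Ideal.span {(ℓ : ℤ)}).primesOver (𝓞 K)).ncard = 1 ∧ ¬ (ℓ : ℤ) ∣ NumberField.discr K) →
        (∀ ℓ : ℕ, ℓ.Prime → ℓ ∣ N → ℓ ∉ S → ((Ideal.span {(ℓ : ℤ)}).primesOver (𝓞 K)).ncard = 2) →
        p ∈ S → ¬ (p : ℤ) ∣ Dt.c → P₀.IsMinimalFor W →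
        ∃ (ι : K →+* ℂ) (y : (W.baseChange K).toAffine.Point) (degy : ℕ)
          (ys : (m : ℕ) → (W.baseChange (ringClassField K ι m)).toAffine.Point) (ε : ℤ), 0 < degy ∧
          padicValNat p degy = padicValNat p P₀.deg ∧
          LDerivEK W K = 8 * (Real.pi : ℂ) ^ 2 * ModularForms.peterssonProduct (CongruenceSubgroup.Gamma0 N) 2 Dt.f Dt.f /
              ((((NumberField.Units.torsionOrder K : ℝ) / 2) ^ 2 * √|(NumberField.discr K : ℝ)| : ℝ) : ℂ) *
            ((y.canonicalHeight : ℂ) / (degy : ℂ)) ∧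
          (¬ IsOfFinAddOrder y → 0 < (AddSubgroup.zmultiples y).index) ∧
          Theorems.ShimuraWalk.LabelsAt W N K ι y ys ε ∧
          ∀ (q : ℕ) [Fact q.Prime], q ∣ N → q ∉ S → p ∣ (W.baseChange ℚ_[q]).localTamagawaNumber ℤ_[q] →
            ∃ n' : ℕ, ¬ p ∣ n' ∧ ∀ m : ℕ, Squarefree m →
              (∀ r ∈ m.primeFactors, ¬ r ∣ N ∧ (Ideal.span {(r : 𝓞 K)}).IsPrime) →
              ∀ [NumberField (ringClassField K ι m)] (w : IsDedekindDomain.HeightOneSpectrum (𝓞 (ringClassField K ι m))),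
                ((q : ℕ) : 𝓞 (ringClassField K ι m)) ∈ w.asIdeal →
                (placeIntModel W (ringClassField K ι m) w).HasNonsingularReduction (K := ringClassField K ι m) (n' • ys m)) :
    EulerHalfNotRamNoInertSetAtFive :=
  eulerHalfNotRamNoInertSetAtFive_of_items_of_twoPrintFacts_of_SAV h₅ h₃ hJL hCO hCTi hESi hF₁ hF₃
    (Theorems.EulerHalfInertUpToOne.stub_shimuraInertSavedDisplayAtFive_of_carrierLabelsE0Prime
      (X11b.Three.Koly.poitouTate_conj_forall_of_selmerComplement_canonical
        fun K _ _ n _ ↦ Theorems.SchneiderFreeAdditiveX3.PoitouTateReduction.selmerComplement_canonical_holds K n)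
      hCTi hLabE0T)

/-- **CRUX 19715 BY NAME FROM THE SIX ROUTE ITEMS + THE TWO PRINTED FACTS + LAB♭** (LAB with its (B6) conjunct at each carrier replaced by the RECEPTACLE-currency
label «`∃ n'` coprime to `p`, `n' • (e (γ • ys m))_v ∈ E0Receptacle (E⁄K) v` …», bsd-idea-9 g7's `Lines/aux_norm_receptacle.md`): §1 on the SAV supplier
`EulerHalfInertUpToOne.stub_shimuraInertSavedDisplayAtFive_of_carrierLabelsReceptacle`. LAB ⟹ LAB′ ⟹ LAB♭, so this is the WEAKEST of the three typings.
CONDITIONAL; 19715 NOT closed by this helper. [cite: GrossLMS1991, §6, proof of Prop. 6.2 (1), p. 245] [cite: Jetchev2008, Cor. 1.5] -/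
theorem eulerHalfNotRamNoInertSetAtFive_of_items_of_twoPrintFacts_of_LABFlat
    (h₅ : PublishedInputsFive) (h₃ : X11aLowerHalf) (hJL : ShimuraParametrizationDataNonempty)
    (hCO : PastenComponentOrdersInput) (hCTi : ShimuraCasselsTateLevelInputs)
    (hESi : ShimuraHeegnerEulerSystemInertPrintedR)
    (hF₁ : GrossLMS1991.prop37_2_frobeniusCongruence)
    (hF₃ : Gross1991_heegnerPoint_sub_ratTorsion_mem_E0)
    (hLabRecT : ∀ (W : WeierstrassCurve ℚ) [W.IsElliptic] [W.IsGloballyMinimal] (p : ℕ) [Fact p.Prime],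
      ClassX11b W p → 5 ≤ p →
      ∀ (N : ℕ) [NeZero N] (K : Type) [Field K] [NumberField K] (S : Finset ℕ) (Dt : ModularForms.ModularParametrizationData W N)
        (X : Literature.NumberTheory.Automorphic.ShimuraCurveData (∏ q ∈ S, q) (N / ∏ q ∈ S, q)) (W' : WeierstrassCurve ℚ) [W'.IsElliptic]
        (P₀ : Literature.NumberTheory.Automorphic.ShimuraParametrizationData X W'),
        W.conductorNorm ℤ = N → IsImaginaryQuadratic K → NumberField.discr K < -4 → Even S.card →
        (∀ ℓ ∈ S, ℓ.Prime ∧ ℓ ∣ N ∧ ¬ ℓ ^ 2 ∣ N ∧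
          ((Ideal.span {(ℓ : ℤ)}).primesOver (𝓞 K)).ncard = 1 ∧ ¬ (ℓ : ℤ) ∣ NumberField.discr K) →
        (∀ ℓ : ℕ, ℓ.Prime → ℓ ∣ N → ℓ ∉ S → ((Ideal.span {(ℓ : ℤ)}).primesOver (𝓞 K)).ncard = 2) →
        p ∈ S → ¬ (p : ℤ) ∣ Dt.c → P₀.IsMinimalFor W →
        ∃ (ι : K →+* ℂ) (y : (W.baseChange K).toAffine.Point) (degy : ℕ)
          (ys : (m : ℕ) → (W.baseChange (ringClassField K ι m)).toAffine.Point) (ε : ℤ), 0 < degy ∧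
          padicValNat p degy = padicValNat p P₀.deg ∧
          LDerivEK W K = 8 * (Real.pi : ℂ) ^ 2 * ModularForms.peterssonProduct (CongruenceSubgroup.Gamma0 N) 2 Dt.f Dt.f /
              ((((NumberField.Units.torsionOrder K : ℝ) / 2) ^ 2 * √|(NumberField.discr K : ℝ)| : ℝ) : ℂ) *
            ((y.canonicalHeight : ℂ) / (degy : ℂ)) ∧
          (¬ IsOfFinAddOrder y → 0 < (AddSubgroup.zmultiples y).index) ∧
          Theorems.ShimuraWalk.LabelsAt W N K ι y ys ε ∧
          ∀ (q : ℕ) [Fact q.Prime], q ∣ N → q ∉ S → p ∣ (W.baseChange ℚ_[q]).localTamagawaNumber ℤ_[q] →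
            ∃ n' : ℤ, IsCoprime (p : ℤ) n' ∧ ∀ m : ℕ, Squarefree m → (∀ r ∈ m.primeFactors, ¬ r ∣ N ∧ (Ideal.span {(r : 𝓞 K)}).IsPrime) →
              ∀ (e : ringClassField K ι m →ₐ[ℚ] AlgebraicClosure K)
                (γ : ringClassField K ι m ≃ₐ[ℚ] ringClassField K ι m)
                (v : IsDedekindDomain.HeightOneSpectrum (𝓞 K)), ((q : ℕ) : 𝓞 K) ∈ v.asIdeal →
                n' • pointsMap (W.baseChange K) (v.adicCompletion K)
                    (WeierstrassCurve.Affine.Point.map (W' := W) e (pointGalHom W (ringClassField K ι m) γ (ys m))) ∈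
                  X11b.E0Receptacle (W.baseChange K) v ∧
                ∀ (m' : ℕ), Squarefree m' → (∀ r ∈ m'.primeFactors, ¬ r ∣ N ∧ (Ideal.span {(r : 𝓞 K)}).IsPrime) →
                  ∀ (hle : ringClassField K ι m' ≤ ringClassField K ι m),
                  n' • pointsMap (W.baseChange K) (v.adicCompletion K)
                      (WeierstrassCurve.Affine.Point.map (W' := W) e (pointGalHom W (ringClassField K ι m) γ
                        (WeierstrassCurve.Affine.Point.map (W' := W)
                          ((RingClassField.inclusion ι hle).restrictScalars ℚ) (ys m')))) ∈
                    X11b.E0Receptacle (W.baseChange K) v) :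
    EulerHalfNotRamNoInertSetAtFive :=
  eulerHalfNotRamNoInertSetAtFive_of_items_of_twoPrintFacts_of_SAV h₅ h₃ hJL hCO hCTi hESi hF₁ hF₃
    (Theorems.EulerHalfInertUpToOne.stub_shimuraInertSavedDisplayAtFive_of_carrierLabelsReceptacle
      (X11b.Three.Koly.poitouTate_conj_forall_of_selmerComplement_canonical
        fun K _ _ n _ ↦ Theorems.SchneiderFreeAdditiveX3.PoitouTateReduction.selmerComplement_canonical_holds K n)
      hCTi hLabRecT)

end Summit.BirchSwinnertonDyer.BirchSwinnertonDyer.Theorems.EulerHalfBirthAssembly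

end
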